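import Summits.MatrixMultiplication.OmegaCensus.BoxUsefulCentreLiftCore

/-!
# ω-census, family (b3): conjecture C9 (b) — the CENTRE-LIFTING THEOREM: centre index `6` does not survive a non-trivial central extension

HONEST FRAMING (pub-omega census; verbatim): lottery ticket; floor = certified bounds/negative ranges.
Census BOOKKEEPING (conjecture C9 of the cell, STRUCTURE.md §2; pub-omega kernel-l4 gen 16, task K-5, structure part).

**Theorem (`CentreLift.index_center_eq_six`).** Let `G` be a finite box-useful group whose central quotient `Ḡ = G/Z(G)` has
centre of index `6`.  Then `Z(G)` itself has index `6`, i.e. `Z₂(G) = Z(G)`.  Equivalently: in the induction on `|G|` behind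
C9 (b), the case '`G/Z(G)` is of the centre-index-`6` class' lifts to '`G` is of the centre-index-`6` class' — no box-useful
group has `G/Z ≅ D₁₂`, `Dic₃ × C₂ / …`-type central quotient with a strictly larger second centre (the census instances: `D₂₄`,
`Dic₆`, `C₃ ⋊ D₈`, `S₃ × D₈`, `S₃ × Q₈`, `C₃ ⋊ Q₁₆`, … are all box-useless).
*Proof (classification-free).* Second-central elements of odd order are central (`BoxUsefulSecondCentre` + a prime-by-prime
argument), so some `2`-element `u ∈ Z₂ ∖ Z` fails to commute with a `2`-element `t`; conjugating into one Sylow `2`-subgroup `P`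
makes `P` non-abelian with `[P : P ∩ Z₂] = 2`.  A `3`-element `r ∉ Z₂` and a `2`-element `s ∈ P ∖ Z₂` give the commutator
`a = ⁅r, s⁆`, a non-trivial `3`-element inverted by `s` (and by all of `P ∖ Z₂`) and centralised by `P ∩ Z₂`; if `9 ∣ |a|` the
`D₁₈`-configuration applies, otherwise `a³ = 1` and a non-commuting pair `x ∈ P ∖ Z₂`, `y ∈ P ∩ Z₂` (which exists as `P` is
non-abelian) with `c = ⁅x, y⁆` — central, made an involution by replacing `y` by a power — is exactly the `D₂₄`-configuration.
Nothing here is progress on `ω`.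
-/


namespace Summit.MatrixMultiplication.OmegaCensus

open Finset ProductBoxBound
open scoped commutatorElement

namespace CentreLift

variable {G : Type*} [Group G] [Fintype G] [DecidableEq G]

/-- **The centre-lifting theorem.** If `G` is box-useful and `Z(G/Z(G))` has index `6`, then `Z(G)` has index `6`. [folklore] -/
theorem index_center_eq_six (hG : BoxUseful G) (h6 : (Subgroup.center (G ⧸ Subgroup.center G)).index = 6) :
    (Subgroup.center G).index = 6 := by
  classical
  haveI : Fact (Nat.Prime 2) := ⟨Nat.prime_two⟩
  haveI : Fact (Nat.Prime 3) := ⟨Nat.prime_three⟩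
  set Z := Subgroup.center G with hZ
  set Gb := G ⧸ Z
  set Q := Gb ⧸ Subgroup.center Gb
  let π : G →* Gb := QuotientGroup.mk' Z
  let π₂ : G →* Q := (QuotientGroup.mk' (Subgroup.center Gb)).comp π
  have hπ₂s : Function.Surjective π₂ := (QuotientGroup.mk'_surjective _).comp (QuotientGroup.mk'_surjective _)
  have cardQ : Nat.card Q = 6 := by rw [← Subgroup.index_eq_card]; exact h6
  -- `Z₂ = ker π₂`; second-central ↔ kernel
  have memZ2 : ∀ u : G, π₂ u = 1 ↔ ∀ g : G, ⁅u, g⁆ ∈ Z := by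
    intro u
    change QuotientGroup.mk' (Subgroup.center Gb) (π u) = 1 ↔ _
    rw [QuotientGroup.mk'_apply, QuotientGroup.eq_one_iff, Subgroup.mem_center_iff]
    constructor
    · intro h g
      have e : π g * π u = π u * π g := h (π g)
      have : π ⁅u, g⁆ = 1 := by
        rw [commutatorElement_def, map_mul, map_mul, map_mul, map_inv, map_inv, ← e]; group
      rwa [QuotientGroup.mk'_apply, QuotientGroup.eq_one_iff] at this
    · intro h q
      obtain ⟨g, rfl⟩ := QuotientGroup.mk'_surjective Z q
      have : π ⁅u, g⁆ = 1 := by rw [QuotientGroup.mk'_apply, QuotientGroup.eq_one_iff]; exact h g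
      rw [commutatorElement_def, map_mul, map_mul, map_mul, map_inv, map_inv] at this
      calc π g * π u = (π u * π g * (π u)⁻¹ * (π g)⁻¹)⁻¹ * (π u * π g) := by group
        _ = π u * π g := by rw [this]; group
  have hZle : Z ≤ π₂.ker := by
    intro z hz
    rw [MonoidHom.mem_ker, memZ2]
    intro g
    have : ⁅z, g⁆ = 1 := by
      rw [commutatorElement_def, ← Subgroup.mem_center_iff.mp hz g]; group
    rw [this]; exact Subgroup.one_mem _
  have hker_idx : π₂.ker.index = 6 := by
    rw [Subgroup.index_ker, MonoidHom.range_eq_top_of_surjective _ hπ₂s, Subgroup.card_top, cardQ]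
  -- it suffices: every second-central element is central
  suffices hmain : ∀ u : G, π₂ u = 1 → u ∈ Z by
    have hK : π₂.ker ≤ Z := fun u hu => hmain u hu
    have e1 : Z.relIndex π₂.ker = 1 := Subgroup.relIndex_eq_one.mpr hK
    have := Subgroup.relIndex_mul_index hZle
    rw [e1, one_mul, hker_idx] at this
    exact this.symm
  intro u hu
  by_contra huZ
  have hu2 : ∀ g, ⁅u, g⁆ ∈ Z := (memZ2 u).1 hu
  ------------------------------------------------------------------
  -- Step A: a second-central `2`-element outside the centre
  obtain ⟨k, m, hm, hn⟩ := Nat.exists_eq_two_pow_mul_odd (orderOf_pos u).ne'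
  have h2k : (2 : ℕ) ^ k ≠ 0 := pow_ne_zero _ two_ne_zero
  have huodd : Odd (orderOf (u ^ 2 ^ k)) := by
    rw [orderOf_pow' u h2k, hn, Nat.gcd_eq_right (Dvd.intro m rfl), Nat.mul_div_cancel_left m (Nat.pos_of_ne_zero h2k)]
    exact hm
  have hu2c : u ^ 2 ^ k ∈ Z := SecondCentre.mem_center_of_odd hG (SecondCentre.pow_secondCentral hu2 _) huodd
  set u₂ := u ^ m with hu₂
  have hu₂2 : ∀ g, ⁅u₂, g⁆ ∈ Z := SecondCentre.pow_secondCentral hu2 m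
  have hu₂ord : orderOf u₂ = 2 ^ k := orderOf_pow_oddPart hn
  have hu₂Z : u₂ ∉ Z := by
    intro h
    apply huZ
    have hcop : Nat.Coprime (2 ^ k) m :=
      Nat.Coprime.pow_left k ((Nat.Prime.coprime_iff_not_dvd Nat.prime_two).mpr hm.not_two_dvd_nat)
    exact mem_of_coprime_pow_mem Z hcop hu2c h
  -- Step B: a `2`-element `t` with `⁅u₂, t⁆ ≠ 1`
  obtain ⟨t₀, ht₀⟩ : ∃ t₀ : G, ⁅u₂, t₀⁆ ≠ 1 := by
    by_contra! hall
    apply hu₂Z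
    rw [Subgroup.mem_center_iff]
    intro g; exact ((SecondCentre.comm_eq_one_iff u₂ g).1 (hall g)).symm
  obtain ⟨j, n, hnodd, htn⟩ := Nat.exists_eq_two_pow_mul_odd (orderOf_pos t₀).ne'
  set t := t₀ ^ n with htdef
  have htord : orderOf t = 2 ^ j := orderOf_pow_oddPart htn
  have ht : ⁅u₂, t⁆ ≠ 1 := by
    rw [htdef, SecondCentre.comm_pow_right hu₂2]
    apply pow_ne_one_of_coprime ht₀
    obtain ⟨i, -, hi⟩ := (Nat.dvd_prime_pow Nat.prime_two).1 (hu₂ord ▸ SecondCentre.orderOf_comm_dvd_left hu₂2 t₀)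
    rw [hi]
    exact Nat.Coprime.pow_left i ((Nat.Prime.coprime_iff_not_dvd Nat.prime_two).mpr hnodd.not_two_dvd_nat)
  -- Step C: one Sylow `2`-subgroup `P` containing `t` and a conjugate `u₃` of `u₂`
  have hPt : IsPGroup 2 (Subgroup.zpowers t) := IsPGroup.of_card (by rw [Nat.card_zpowers, htord])
  have hPu : IsPGroup 2 (Subgroup.zpowers u₂) := IsPGroup.of_card (by rw [Nat.card_zpowers, hu₂ord])
  obtain ⟨P, hP⟩ := hPt.exists_le_sylow
  obtain ⟨P₀, hP₀⟩ := hPu.exists_le_sylow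
  obtain ⟨x₀, hx₀⟩ := MulAction.exists_smul_eq G P₀ P
  have htP : t ∈ (P : Subgroup G) := hP (Subgroup.mem_zpowers t)
  set u₃ := x₀ * u₂ * x₀⁻¹ with hu₃
  have hu₃P : u₃ ∈ (P : Subgroup G) := by
    have e : ((x₀ • P₀ : Sylow 2 G) : Subgroup G) = (P : Subgroup G) := congrArg (fun R : Sylow 2 G => (R : Subgroup G)) hx₀
    rw [Sylow.coe_subgroup_smul] at e
    rw [← e]
    have := Subgroup.smul_mem_pointwise_smul u₂ (MulAut.conj x₀) (P₀ : Subgroup G) (hP₀ (Subgroup.mem_zpowers u₂))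
    simpa [MulAut.smul_def, MulAut.conj_apply] using this
  have hu₃2 : ∀ g, ⁅u₃, g⁆ ∈ Z := SecondCentre.conj_secondCentral hu₂2 x₀
  obtain ⟨w, hw, hwu⟩ := SecondCentre.conj_eq_central_mul hu₂2 x₀
  have hu₃t : ⁅u₃, t⁆ ≠ 1 := by rw [hu₃, hwu, comm_central_mul hw]; exact ht
  have hu₃ker : π₂ u₃ = 1 := (memZ2 u₃).2 hu₃2
  -- every element of `P` has `2`-power order
  have hPord : ∀ p ∈ (P : Subgroup G), ∃ i : ℕ, orderOf p = 2 ^ i := by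
    intro p hp
    obtain ⟨i, hi⟩ := IsPGroup.iff_orderOf.mp P.isPGroup' ⟨p, hp⟩
    exact ⟨i, by rw [← hi, Subgroup.orderOf_mk]⟩
  -- Step D: a `3`-element `r` outside `Z₂`
  obtain ⟨q₃, hq₃⟩ := exists_prime_orderOf_dvd_card' (G := Q) 3 (by rw [cardQ]; norm_num)
  obtain ⟨r₀, hr₀⟩ := hπ₂s q₃
  obtain ⟨b, n', hn', hrn⟩ := Nat.exists_eq_pow_mul_and_not_dvd (orderOf_pos r₀).ne' 3 (by norm_num)
  set r := r₀ ^ n' with hrdef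
  have hr3 : r ^ 3 ^ b = 1 := by rw [hrdef, ← pow_mul, mul_comm, ← hrn]; exact pow_orderOf_eq_one r₀
  have hrodd : Odd (orderOf r) := odd_orderOf_of_pow_three hr3
  have hπr : π₂ r = q₃ ^ n' := by rw [hrdef, map_pow, hr₀]
  have hπr1 : π₂ r ≠ 1 := by
    rw [hπr]; intro h
    exact hn' (hq₃ ▸ orderOf_dvd_of_pow_eq_one h)
  have hn'0 : n' ≠ 0 := fun h => by rw [h, mul_zero] at hrn; exact (orderOf_pos r₀).ne' hrn
  have hπr3 : orderOf (π₂ r) = 3 := by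
    rw [hπr, orderOf_pow' q₃ hn'0, hq₃, Nat.Coprime.gcd_eq_one ((Nat.Prime.coprime_iff_not_dvd Nat.prime_three).mpr hn'),
      Nat.div_one]
  -- a `2`-element `s₂ ∈ P` outside `Z₂`
  obtain ⟨q₂, hq₂⟩ := exists_prime_orderOf_dvd_card' (G := Q) 2 (by rw [cardQ]; norm_num)
  obtain ⟨s₀, hs₀⟩ := hπ₂s q₂
  obtain ⟨j', n₂, hn₂, hsn⟩ := Nat.exists_eq_two_pow_mul_odd (orderOf_pos s₀).ne'
  set s₁ := s₀ ^ n₂ with hs₁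
  have hs₁ord : orderOf s₁ = 2 ^ j' := orderOf_pow_oddPart hsn
  have hπs₁ : π₂ s₁ ≠ 1 := by
    rw [hs₁, map_pow, hs₀]
    apply pow_ne_one_of_coprime (fun h => by rw [h, orderOf_one] at hq₂; exact absurd hq₂ (by norm_num))
    rw [hq₂]; exact (Nat.Prime.coprime_iff_not_dvd Nat.prime_two).mpr hn₂.not_two_dvd_nat
  have hPs : IsPGroup 2 (Subgroup.zpowers s₁) := IsPGroup.of_card (by rw [Nat.card_zpowers, hs₁ord])
  obtain ⟨P₁, hP₁⟩ := hPs.exists_le_sylow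
  obtain ⟨x₁, hx₁⟩ := MulAction.exists_smul_eq G P₁ P
  set s₂ := x₁ * s₁ * x₁⁻¹ with hs₂
  have hs₂P : s₂ ∈ (P : Subgroup G) := by
    have e : ((x₁ • P₁ : Sylow 2 G) : Subgroup G) = (P : Subgroup G) := congrArg (fun R : Sylow 2 G => (R : Subgroup G)) hx₁
    rw [Sylow.coe_subgroup_smul] at e
    rw [← e]
    have := Subgroup.smul_mem_pointwise_smul s₁ (MulAut.conj x₁) (P₁ : Subgroup G) (hP₁ (Subgroup.mem_zpowers s₁))
    simpa [MulAut.smul_def, MulAut.conj_apply] using this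
  have hπs₂ : π₂ s₂ ≠ 1 := by
    intro h; apply hπs₁
    have e : π₂ s₂ = π₂ x₁ * π₂ s₁ * (π₂ x₁)⁻¹ := by rw [hs₂, map_mul, map_mul, map_inv]
    rw [e] at h
    calc π₂ s₁ = (π₂ x₁)⁻¹ * (π₂ x₁ * π₂ s₁ * (π₂ x₁)⁻¹) * π₂ x₁ := by group
      _ = 1 := by rw [h]; group
  -- Step E: choose `s ∈ P ∖ Z₂`, `x ∈ Z₂ s`, `y ∈ P ∩ Z₂` with `⁅y, x⁆ ≠ 1`
  obtain ⟨s, x, y, hsP, hπs, hxs, hyP, hπy, hyx⟩ : ∃ s x y : G, s ∈ (P : Subgroup G) ∧ π₂ s ≠ 1 ∧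
      π₂ (x * s⁻¹) = 1 ∧ y ∈ (P : Subgroup G) ∧ π₂ y = 1 ∧ ⁅y, x⁆ ≠ 1 := by
    by_cases hπt : π₂ t = 1
    · by_cases h1 : ⁅u₃, s₂⁆ = 1
      · by_cases h2 : ⁅t, s₂⁆ = 1
        · refine ⟨s₂, s₂ * t, u₃, hs₂P, hπs₂, ?_, hu₃P, hu₃ker, ?_⟩
          · rw [map_mul, map_mul, map_inv, hπt, mul_one, mul_inv_cancel]
          · rw [SecondCentre.comm_mul hu₃2, h1, one_mul]; exact hu₃t
        · exact ⟨s₂, s₂, t, hs₂P, hπs₂, by rw [mul_inv_cancel, map_one], htP, hπt, h2⟩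
      · exact ⟨s₂, s₂, u₃, hs₂P, hπs₂, by rw [mul_inv_cancel, map_one], hu₃P, hu₃ker, h1⟩
    · exact ⟨t, t, u₃, htP, hπt, by rw [mul_inv_cancel, map_one], hu₃P, hu₃ker, hu₃t⟩
  have hy2 : ∀ g, ⁅y, g⁆ ∈ Z := (memZ2 y).1 hπy
  have hk2 : ∀ g, ⁅x * s⁻¹, g⁆ ∈ Z := (memZ2 _).1 hxs
  -- `s² ∈ Z₂`
  obtain ⟨i, hi⟩ := hPord s hsP
  have hπs_dvd : orderOf (π₂ s) ∣ 2 := by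
    have d1 : orderOf (π₂ s) ∣ 2 ^ i := hi ▸ orderOf_map_dvd π₂ s
    have d2 : orderOf (π₂ s) ∣ 6 := cardQ ▸ orderOf_dvd_natCard (π₂ s)
    obtain ⟨l, -, hl⟩ := (Nat.dvd_prime_pow Nat.prime_two).1 d1
    have hl1 : l ≤ 1 := by
      by_contra hl2
      have h4 : 4 ∣ 6 := (pow_dvd_pow 2 (show 2 ≤ l by omega)).trans (hl ▸ d2)
      omega
    rw [hl]; exact pow_dvd_pow 2 hl1
  have hπs2 : orderOf (π₂ s) = 2 := by
    rcases (Nat.dvd_prime Nat.prime_two).1 hπs_dvd with h | h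
    · exact absurd (orderOf_eq_one_iff.mp h) hπs
    · exact h
  have hss : π₂ (s * s) = 1 := by
    rw [map_mul, ← pow_two]; exact orderOf_dvd_iff_pow_eq_one.mp hπs_dvd
  have hs2r : s * s * r = r * (s * s) := SecondCentre.comm_of_odd hG ((memZ2 _).1 hss) hrodd
  -- `r' = s r s⁻¹` commutes with `r`
  set r' := s * r * s⁻¹ with hr'
  have hrr' : r * r' = r' * r := by
    -- in `Q`, `⟨π₂ r⟩` has index `2`, hence is normal; so `π₂ r' = (π₂ r)^i`
    set N : Subgroup Q := Subgroup.zpowers (π₂ r) with hN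
    have hNcard : Nat.card N = 3 := by rw [hN, Nat.card_zpowers, hπr3]
    have hNidx : N.index = 2 := by
      have := N.card_mul_index; rw [hNcard, cardQ] at this; omega
    haveI : N.Normal := Subgroup.normal_of_index_eq_two hNidx
    have hmem : π₂ s * π₂ r * (π₂ s)⁻¹ ∈ N := Subgroup.Normal.conj_mem inferInstance _ (Subgroup.mem_zpowers _) _
    obtain ⟨i, hi⟩ := Subgroup.mem_zpowers_iff.mp hmem
    -- `w = r' (r^i)⁻¹ ∈ Z₂`
    have hw : π₂ (r' * (r ^ i)⁻¹) = 1 := by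
      rw [map_mul, map_inv, map_zpow, hi, hr', map_mul, map_mul, map_inv, mul_inv_cancel]
    have hwr : (r' * (r ^ i)⁻¹) * r = r * (r' * (r ^ i)⁻¹) := SecondCentre.comm_of_odd hG ((memZ2 _).1 hw) hrodd
    calc r * r' = r * (r' * (r ^ i)⁻¹) * r ^ i := by group
      _ = (r' * (r ^ i)⁻¹) * r * r ^ i := by rw [← hwr]
      _ = r' * r := by group
  -- the element `a = r r'⁻¹ = ⁅r, s⁆`
  set a := r * r'⁻¹ with hadef
  have hcomm : Commute r r'⁻¹ := (show Commute r r' from hrr').inv_right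
  have hr'3 : r' ^ 3 ^ b = 1 := by rw [hr', conj_pow', hr3]; group
  have ha3b : a ^ 3 ^ b = 1 := by rw [hadef, hcomm.mul_pow, inv_pow, hr3, hr'3, inv_one, one_mul]
  have haodd : Odd (orderOf a) := odd_orderOf_of_pow_three ha3b
  have ha1 : a ≠ 1 := by
    intro h
    have hrs : s * r = r * s := by
      have e1 : r = r' := by
        calc r = r * r'⁻¹ * r' := by group
          _ = r' := by rw [← hadef, h, one_mul]
      calc s * r = s * r * s⁻¹ * s := by group
        _ = r * s := by rw [← hr', ← e1]
    have hc : Commute (π₂ r) (π₂ s) := by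
      change π₂ r * π₂ s = π₂ s * π₂ r
      rw [← map_mul, ← map_mul, hrs]
    have hord6 : orderOf (π₂ r * π₂ s) = 6 := by
      rw [hc.orderOf_mul_eq_mul_orderOf_of_coprime (by rw [hπr3, hπs2]; decide), hπr3, hπs2]
    haveI : IsCyclic Q := isCyclic_of_orderOf_eq_card (π₂ r * π₂ s) (by rw [hord6, cardQ])
    have hcommG := (QuotientGroup.mk' (Subgroup.center Gb)).isMulCommutative_of_isCyclic_of_ker_le_center
      (by rw [QuotientGroup.ker_mk'])
    have htop : Subgroup.center Gb = ⊤ := by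
      rw [eq_top_iff]; intro q _; rw [Subgroup.mem_center_iff]; intro g; exact hcommG.is_comm.comm g q
    have h6' := h6
    rw [htop, Subgroup.index_top] at h6'
    exact absurd h6' (by norm_num)
  have hsa : s * a * s⁻¹ = a⁻¹ := by
    have e : r⁻¹ * (s * s)⁻¹ = (s * s)⁻¹ * r⁻¹ := by rw [← mul_inv_rev, ← mul_inv_rev, hs2r]
    rw [hadef, hr']
    calc s * (r * (s * r * s⁻¹)⁻¹) * s⁻¹ = s * r * s * (r⁻¹ * (s * s)⁻¹) := by group
      _ = s * r * s * ((s * s)⁻¹ * r⁻¹) := by rw [e]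
      _ = (r * (s * r * s⁻¹)⁻¹)⁻¹ := by group
  -- `x ∈ Z₂ s` inverts `a`, `y ∈ Z₂` centralises `a`
  have hka : (x * s⁻¹) * a = a * (x * s⁻¹) := SecondCentre.comm_of_odd hG hk2 haodd
  have hxa : x * a * x⁻¹ = a⁻¹ := by
    have hka' : (x * s⁻¹) * a⁻¹ = a⁻¹ * (x * s⁻¹) := ((show Commute (x * s⁻¹) a from hka).inv_right).eq
    calc x * a * x⁻¹ = (x * s⁻¹) * (s * a * s⁻¹) * (x * s⁻¹)⁻¹ := by group
      _ = (x * s⁻¹) * a⁻¹ * (x * s⁻¹)⁻¹ := by rw [hsa]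
      _ = a⁻¹ := by rw [hka']; group
  have hya : y * a = a * y := SecondCentre.comm_of_odd hG hy2 haodd
  exact core hG ha3b ha1 hxa hya hy2 hyx (hPord y hyP)
end CentreLift

end Summit.MatrixMultiplication.OmegaCensus
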